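import Mathlib
import Summits.NavierStokesRegularity.NavierStokesRegularity.Theorems.ThreadingFluxHorizonTowerL2ClosedFormLaw
import Summits.NavierStokesRegularity.NavierStokesRegularity.Theorems.ThreadingFluxHorizonTowerHarmonicCubic
import HarnessLib

/-!
# Crux `PoloidalLiouville` (stmt-NavierStokesRegularity-1222, wall W1), crux idea «horizon-threading-tower» (ns-idea-15):
# the table cell `HorizonL2Quadrupole` (degree 2) BY NAME — `𝔏₂[U_Q] = −256 det(y, Qy, Q²y)/r³`

Support file (Theorems-side tooling; seat ns-wall-eng-4 g2, cell ns-wall-extremal, W1 adjunct; `--supports stmt-NavierStokesRegularity-1222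
--as helper`).  The `l = 2` instance of the closed-form law `HorizonTower.horizonL2_horizonProfile_eq_det` (p672188) for the traceless
symmetric quadratic form `H(y) = ⟪y, Qy⟫` (`IsShapeTensor Q`): `∇H = 2Qy`, `∇‖∇H‖² = 8Q²y`, `ΔH = 2 tr Q = 0`, `κ₂ = 4`, so
`𝔏₂[U_Q](x) = −16 · ⟪2Qx, 8Q²x × x⟫/‖x‖³ = −256 ⟪x, Qx × Q²x⟫/‖x‖³`.

* `HorizonTower.quadForm_smul`, `contDiff_quadForm`, `gradient_quadForm`, `laplacian_quadForm`, `gradient_gradNormSq_quadForm` — calculus of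
  the quadratic form of a (symmetric, traceless) `Q : ℝ³ →L ℝ³`;
* ★ `HorizonTower.horizonL2Quadrupole : HorizonL2Quadrupole` — the TABLE CELL of `ThreadingFluxHorizonTowerDefs.lean` by name (the bounded
  endpoint `σ = 1` of the g0 card: `𝔏₂` vanishes iff `det(y, Qy, Q²y) ≡ 0`, i.e. iff `Q` is uniaxial).

HONEST LABEL: an exact algebraic identity about the typed objects of one crux idea (engine E4 entry, now kernel); information-grade for W1/W2
(movement 0); `PoloidalLiouville` (1222), `UnthreadedRigidity` (27585) and NS regularity remain OPEN and untouched.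
[cite: MajdaBertozziCUP2002, §1.1 (vector identities)]
-/

-- the summit and its single problem share the name (D-0017 nested layout)
set_option linter.dupNamespace false

noncomputable section

open Set Function Filter Topology
open scoped Topology RealInnerProductSpace
open Literature.Analysis.FluidPDE

namespace Summit.NavierStokesRegularity.NavierStokesRegularity.Theorems.PoloidalLiouville.HorizonTower

section Quadrupole

variable (Q : E3 →L[ℝ] E3)

/-- The quadratic form `y ↦ ⟪y, Qy⟫` is homogeneous of degree two. [folklore] -/
theorem quadForm_smul (c : ℝ) (y : E3) : ⟪c • y, Q (c • y)⟫ = c ^ 2 * ⟪y, Q y⟫ := by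
  rw [map_smul, real_inner_smul_left, real_inner_smul_right]
  ring

/-- The quadratic form `y ↦ ⟪y, Qy⟫` is smooth. [folklore] -/
theorem contDiff_quadForm : ContDiff ℝ (⊤ : ℕ∞) (fun y : E3 => ⟪y, Q y⟫) :=
  contDiff_id.inner ℝ Q.contDiff

/-- `∇⟪y, Qy⟫ = 2Qy` for symmetric `Q`. [folklore] -/
theorem gradient_quadForm (hQs : ∀ a b : E3, ⟪Q a, b⟫ = ⟪a, Q b⟫) (x : E3) :
    gradient (fun y : E3 => ⟪y, Q y⟫) x = (2 : ℝ) • Q x := by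
  have hd : HasFDerivAt (fun y : E3 => ⟪y, Q y⟫)
      ((fderivInnerCLM ℝ ((x, Q x) : E3 × E3)).comp ((ContinuousLinearMap.id ℝ E3).prod Q)) x :=
    (hasFDerivAt_id x).inner ℝ Q.hasFDerivAt
  apply ext_inner_right ℝ
  intro v
  rw [Literature.Analysis.FluidPDE.inner_gradient_left, hd.fderiv, real_inner_smul_left]
  simp only [ContinuousLinearMap.comp_apply, ContinuousLinearMap.prod_apply, ContinuousLinearMap.id_apply,
    fderivInnerCLM_apply]
  rw [← hQs x v, real_inner_comm (Q x) v]
  ring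

/-- `∇‖∇⟪y, Qy⟫‖² = 8Q(Qy)` for symmetric `Q`. [folklore] -/
theorem gradient_gradNormSq_quadForm (hQs : ∀ a b : E3, ⟪Q a, b⟫ = ⟪a, Q b⟫) (x : E3) :
    gradient (fun w : E3 => ‖gradient (fun y : E3 => ⟪y, Q y⟫) w‖ ^ 2) x = (8 : ℝ) • Q (Q x) := by
  have hg : (fun w : E3 => ‖gradient (fun y : E3 => ⟪y, Q y⟫) w‖ ^ 2) = fun w : E3 => 4 * ‖Q w‖ ^ 2 := by
    funext w
    rw [gradient_quadForm Q hQs, norm_smul, mul_pow, Real.norm_eq_abs]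
    norm_num
  rw [hg, OrderTwo.gradient_const_mul' (Q.differentiableAt.norm_sq ℝ) 4]
  have hd : HasFDerivAt (fun w : E3 => ‖Q w‖ ^ 2) ((2 : ℕ) • (innerSL ℝ (Q x)).comp Q) x := Q.hasFDerivAt.norm_sq
  apply ext_inner_right ℝ
  intro v
  rw [real_inner_smul_left, real_inner_smul_left, Literature.Analysis.FluidPDE.inner_gradient_left, hd.fderiv, two_nsmul,
    _root_.add_apply, ContinuousLinearMap.comp_apply, innerSL_apply_apply, hQs (Q x) v]
  ring

/-- `Δ⟪y, Qy⟫ = 2 tr Q = 0` for a traceless `Q` (Laplacian from line restrictions). [folklore] -/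
theorem laplacian_quadForm (hQ : IsShapeTensor Q) (x : E3) : Laplacian.laplacian (fun y : E3 => ⟪y, Q y⟫) x = 0 := by
  have h2 : ContDiff ℝ 2 (fun y : E3 => ⟪y, Q y⟫) := (contDiff_quadForm Q).of_le (by norm_cast)
  rw [laplacian_eq_sum_iteratedDeriv_line h2]
  have hline : ∀ m : Fin 3, iteratedDeriv 2 (fun t : ℝ => ⟪x + t • EuclideanSpace.single m (1 : ℝ),
      Q (x + t • EuclideanSpace.single m (1 : ℝ))⟫) 0
      = 2 * ⟪(EuclideanSpace.single m (1 : ℝ) : E3), Q (EuclideanSpace.single m (1 : ℝ))⟫ := by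
    intro m
    have hfun : (fun t : ℝ => ⟪x + t • EuclideanSpace.single m (1 : ℝ), Q (x + t • EuclideanSpace.single m (1 : ℝ))⟫)
        = fun t : ℝ => ⟪x, Q x⟫ + t * (⟪(EuclideanSpace.single m (1 : ℝ) : E3), Q x⟫ + ⟪x, Q (EuclideanSpace.single m (1 : ℝ))⟫)
          + t ^ 2 * ⟪(EuclideanSpace.single m (1 : ℝ) : E3), Q (EuclideanSpace.single m (1 : ℝ))⟫ + t ^ 3 * 0 := by
      funext t
      rw [map_add, map_smul, inner_add_left, inner_add_right, inner_add_right, real_inner_smul_left, real_inner_smul_left,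
        real_inner_smul_right, real_inner_smul_right]
      ring
    rw [hfun, iteratedDeriv_two_cubic]
  simp only [hline]
  rw [← Finset.mul_sum]
  have htr : ∑ m : Fin 3, ⟪(EuclideanSpace.single m (1 : ℝ) : E3), Q (EuclideanSpace.single m (1 : ℝ))⟫
      = LinearMap.trace ℝ E3 (Q : E3 →ₗ[ℝ] E3) := by
    rw [LinearMap.trace_eq_sum_inner _ (EuclideanSpace.basisFun (Fin 3) ℝ)]
    simp
  rw [htr, hQ.2, mul_zero]

/-- ★ **The table cell `HorizonL2Quadrupole` BY NAME**: for a traceless symmetric `Q` and `H = ⟪y, Qy⟫`,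
`𝔏₂[U_Q](x) = −256 ⟪x, Qx × Q(Qx)⟫/‖x‖³` off the origin (zero iff `Q` is uniaxial, i.e. the shell is axisymmetric).
The `l = 2` instance of `horizonL2_horizonProfile_eq_det`. -/
theorem horizonL2Quadrupole : HorizonL2Quadrupole := by
  intro Q hQ x hx
  rw [horizonL2_horizonProfile_eq_det (l := 2) (by norm_num) (contDiff_quadForm Q) (fun c y => quadForm_smul Q c y)
    (laplacian_quadForm Q hQ) hx, gradient_gradNormSq_quadForm Q hQ.1, gradient_quadForm Q hQ.1,
    Tao2016.cross_smul_left, real_inner_smul_left, real_inner_smul_right, OrderTwo.inner_cross_cyclic,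
    OrderTwo.inner_cross_cyclic]
  have h3 : ‖x‖ ^ (3 * (2 - 1)) = ‖x‖ ^ 3 := by norm_num
  rw [h3]
  push_cast
  ring

end Quadrupole

end Summit.NavierStokesRegularity.NavierStokesRegularity.Theorems.PoloidalLiouville.HorizonTower

end
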